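import Summits.Schanuel.Schanuel.Theorems.DiophantineDichotomyKhovanskiiApproxTypeLWLayerPrinted
import Summits.Schanuel.Schanuel.Theorems.DiophantineDichotomyKhovanskiiApproxTypeLWLayer
import Summits.Schanuel.Schanuel.Theorems.DiophantineDichotomyKhovanskiiApproxTypeExpFiniteType

/-!
# `KhovanskiiApproxType` (stmt-Schanuel-6116) from Ably's theorem and the remaining stub statements
# of line `height-window-compactness` — the composition, kernel-checked

Route `DiophantineDichotomy` (sub-problem `Schanuel/Schanuel`), item `KhovanskiiApproxType`
(stmt-Schanuel-6116: the ALL-HEIGHTS simultaneous approximation measure `a < 1/(n−1)` at every free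
Khovanskii point), line `height-window-compactness` (checked skeleton
`Cruxes/KhovanskiiApproxType/Lines/height_window_compactness.lean`, 7 registered stubs; vocabulary
`Theorems/DiophantineDichotomyDefs.lean`).

This file lands the skeleton's sorry-free COMPOSITION with every stub that could be discharged
discharged: stub 1 (`LWPenaltyMeasure`) from the vendored named fact
`Literature.NumberTheory.Transcendental.Ably1994_lindemannWeierstrass_measure`
(`lwPenaltyMeasure_of_ably`, file `…LWLayerPrinted.lean`), stub 2 (`stub_penaltyTransfer`,
p85905) and stub 3 (`stub_penaltySlotDichotomy_two`, p94631) proved. What remains hypothetical is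
named in the signature of `khovanskiiApproxType_of_ably`:

* `ExpFiniteType` — PRINTED (Lang's finite type of transcendence of `e^β`, `β ∈ ℚ̄*`): derived
  with `τ = 5` from the vendored named fact `Waldschmidt1978_cor_3_9` (Waldschmidt 1978,
  Corollary 3.9) in `…ExpFiniteType.lean` (`expFiniteType_of_waldschmidt`), used only BELOW
  `exp(d^{b₀})` through `approxFloor_of_finiteType` (proved here) — so `khovanskiiApproxType_of_printed`
  takes the Waldschmidt fact instead;
* `LWWindowTwo` — OPEN, beyond print: the typed bound in the height window
  `exp(d^{b₀}) ≤ H < exp(exp(κ d log(d+2)))` at Lindemann–Weierstrass points (the surplus of the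
  all-heights item over the eventual crux `KhovanskiiApproxTypeEv`);
* `NonLWInputsTwo` — OPEN, Schanuel-strength (at `s = (1, iπ)` it contains `e ⊥ π` with a
  measure);
* `RankThreeUp` — OPEN: the item itself for `n ≥ 3`.

So after this pass the item is EXACTLY `Ably 1994 (printed, vendored) + Waldschmidt 1978 Cor. 3.9
(printed, vendored) + three open statements`, with all plumbing kernel-checked; its eventual Lindemann–Weierstrass
layer (the part the route consumes) is reduced to Ably's theorem alone (`evLW_two_of_ably`).
Everything here is proved; the named fact enters only as a hypothesis.
-/

noncomputable section

-- `Summit.Schanuel.Schanuel.…` is the mandated summit/sub-problem namespace (single-conjunct summit), hence: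
set_option linter.dupNamespace false

namespace Summit.Schanuel.Schanuel.Cruxes.KhovanskiiApproxType.HeightWindowCompactness

open Summit.Schanuel.Schanuel.Cruxes.KhovanskiiApproxType.LwSmallHeight
open Literature.NumberTheory.Transcendental (Ably1994_lindemannWeierstrass_measure)
open Polynomial

/-! ## The all-heights item 6116 from Ably's theorem and the four remaining stub statements -/

namespace WindowComposition

/-- Monotonicity of the typed exponent `C(dᵃ L + dᵇ)` in `(a, b, C)` for `d ≥ 1`, `L ≥ 0`.
(The skeleton's `typedExponent_mono`.) [folklore] -/
theorem typedExponent_mono {d L a a' b b' C C' : ℝ} (hd : 1 ≤ d) (hL : 0 ≤ L) (hC : 0 ≤ C)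
    (hCC' : C ≤ C') (ha : a ≤ a') (hb : b ≤ b') :
    C * (d ^ a * L + d ^ b) ≤ C' * (d ^ a' * L + d ^ b') := by
  have hd0 : 0 ≤ d := zero_le_one.trans hd
  have h1 : d ^ a ≤ d ^ a' := Real.rpow_le_rpow_of_exponent_le hd ha
  have h2 : d ^ b ≤ d ^ b' := Real.rpow_le_rpow_of_exponent_le hd hb
  have h3 : 0 ≤ d ^ a' * L + d ^ b' :=
    add_nonneg (mul_nonneg (Real.rpow_nonneg hd0 _) hL) (Real.rpow_nonneg hd0 _)
  have h4 : d ^ a * L + d ^ b ≤ d ^ a' * L + d ^ b' :=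
    add_le_add (mul_le_mul_of_nonneg_right h1 hL) h2
  calc C * (d ^ a * L + d ^ b) ≤ C * (d ^ a' * L + d ^ b') := mul_le_mul_of_nonneg_left h4 hC
    _ ≤ C' * (d ^ a' * L + d ^ b') := mul_le_mul_of_nonneg_right hCC' h3

/-- **FLOOR below `exp(d^{b₀})` from finite type at the slot `e^{s₀}`** (the skeleton's
`approxFloor_of_finiteType`): an irreducible factor `f` of the challenger's annihilating
polynomial at that slot vanishes at `γ(e^{s₀}-slot)`, has `deg f ≤ d` and coefficients
`≤ 2^d(d+1)H` (landed `abs_coeff_le_of_dvd`), so Lang's type bound gives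
`|f(e^{s₀})| ≥ exp(−C(d + 2d + log H)^τ)` while the mean value theorem (landed
`norm_aeval_sub_aeval_le`) gives `|f(e^{s₀})| ≤ exp((4 + log R)d + log H)·|γ − θ|`; for
`log H < d^{b₀}` everything is `≤ C' d^B`, `B = max(b₀,1)(τ⁺ + 1)`. [folklore] -/
theorem approxFloor_of_finiteType (s : Fin 2 → ℂ) {τ C : ℝ}
    (hft : HasTranscendenceType (Complex.exp (s 0)) τ C) (b₀ : ℝ) :
    ∃ B C' : ℝ, 0 < C' ∧ ∀ (d H : ℕ) (γ : Fin 2 ⊕ Fin 2 → ℂ),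
      (H : ℝ) < Real.exp ((d : ℝ) ^ b₀) →
      Module.finrank ℚ ↥(IntermediateField.adjoin ℚ (Set.range γ)) ≤ d →
      (∀ i, ∃ P : Polynomial ℤ, P ≠ 0 ∧ P.natDegree ≤ d ∧ (∀ k, |P.coeff k| ≤ (H : ℤ)) ∧
        Polynomial.aeval (γ i) P = 0) →
      Real.exp (-(C' * (d : ℝ) ^ B)) ≤ ‖γ - Sum.elim s (Complex.exp ∘ s)‖ := by
  set θ : Fin 2 ⊕ Fin 2 → ℂ := Sum.elim s (Complex.exp ∘ s) with hθ
  set τp : ℝ := max τ 0 with hτp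
  set B₀ : ℝ := max b₀ 1 with hB₀
  set B : ℝ := B₀ * τp + B₀ with hB
  set R : ℝ := ‖θ‖ + 2 with hR
  set C' : ℝ := C * (4 : ℝ) ^ τp + 5 + Real.log R with hC'
  have hC : 0 < C := hft.1
  have hR1 : 1 ≤ R := by have := norm_nonneg θ; rw [hR]; linarith
  have hlogR : 0 ≤ Real.log R := Real.log_nonneg hR1
  have hτp0 : 0 ≤ τp := le_max_right _ _
  have hB₀1 : 1 ≤ B₀ := le_max_right _ _
  have h4p : 0 ≤ (4 : ℝ) ^ τp := Real.rpow_nonneg (by norm_num) _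
  have hC'pos : 0 < C' := by
    have : 0 ≤ C * (4 : ℝ) ^ τp := mul_nonneg hC.le h4p
    rw [hC']; linarith
  refine ⟨B, C', hC'pos, ?_⟩
  intro d H γ hHlt _hfr hpoly
  obtain ⟨P, hP0, hPdeg, hPH, hPγ⟩ := hpoly (Sum.inr 0)
  obtain ⟨hd1r, hH1r⟩ := one_le_of_clause (hpoly (Sum.inr 0))
  have hd1 : 1 ≤ d := by exact_mod_cast hd1r
  have hd0 : (0 : ℝ) < d := one_pos.trans_le hd1r
  have hH0 : (0 : ℝ) < H := one_pos.trans_le hH1r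
  have hlogH : 0 ≤ Real.log H := Real.log_nonneg hH1r
  have hdB0 : 0 ≤ (d : ℝ) ^ B := Real.rpow_nonneg hd0.le _
  have hX0 : 0 ≤ C' * (d : ℝ) ^ B := mul_nonneg hC'pos.le hdB0
  by_cases hfar : 1 < ‖γ - θ‖
  · exact le_trans (by rw [Real.exp_le_one_iff]; linarith) hfar.le
  push Not at hfar
  have hcoord : ‖γ (Sum.inr 0) - θ (Sum.inr 0)‖ ≤ ‖γ - θ‖ := by
    simpa using norm_le_pi_norm (γ - θ) (Sum.inr 0)
  have hθj : ‖θ (Sum.inr 0)‖ ≤ ‖θ‖ := norm_le_pi_norm θ (Sum.inr 0)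
  have hξR : ‖θ (Sum.inr 0)‖ ≤ R := by rw [hR]; linarith
  have hαR : ‖γ (Sum.inr 0)‖ ≤ R := by
    linarith [hcoord, hθj, norm_sub_norm_le (γ (Sum.inr 0)) (θ (Sum.inr 0))]
  -- an irreducible factor of `P` vanishing at the slot, its degree and coefficients
  obtain ⟨f, hfirr, hfP, hfα⟩ := exists_irreducible_factor_aeval_eq_zero (γ (Sum.inr 0)) P hP0 hPγ
  have hf0 : f ≠ 0 := hfirr.ne_zero
  have hfd : f.natDegree ≤ d := (natDegree_le_of_dvd hfP hP0).trans hPdeg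
  set Bh : ℝ := 2 ^ d * ((d : ℝ) + 1) * H with hBh
  have hcoeff : ∀ k, |(f.coeff k : ℝ)| ≤ Bh := abs_coeff_le_of_dvd hfP hP0 hPdeg hPH
  have j1 : (d : ℝ) + 1 ≤ Real.exp d := Real.add_one_le_exp d
  have j2 : (2 : ℝ) ^ d ≤ Real.exp d := by
    calc (2 : ℝ) ^ d ≤ (Real.exp 1) ^ d :=
          pow_le_pow_left₀ (by norm_num) (by linarith [Real.add_one_le_exp (1 : ℝ)]) d
      _ = Real.exp d := by rw [← Real.exp_nat_mul, mul_one]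
  have hBh1 : 1 ≤ Bh :=
    one_le_mul_of_one_le_of_one_le (one_le_mul_of_one_le_of_one_le (one_le_pow₀ (by norm_num))
      (by linarith)) hH1r
  have hBh0 : 0 < Bh := one_pos.trans_le hBh1
  have hlogBh : Real.log Bh ≤ 2 * d + Real.log H := by
    have h : Bh ≤ Real.exp d * Real.exp d * H := by rw [hBh]; gcongr
    have h' := Real.log_le_log hBh0 h
    rw [Real.log_mul (mul_pos (Real.exp_pos _) (Real.exp_pos _)).ne' hH0.ne',
      Real.log_mul (Real.exp_pos _).ne' (Real.exp_pos _).ne', Real.log_exp] at h'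
    linarith
  -- Lang's type bound at `f`, degree `≤ d`, coefficients `≤ Bh`
  have hlow : Real.exp (-(C * ((d : ℝ) + Real.log Bh) ^ τ)) ≤ ‖aeval (θ (Sum.inr 0)) f‖ :=
    hft.2 f d Bh hf0 hd1 hfd hBh1 hcoeff
  -- the mean value bound
  have hmv : ‖aeval (θ (Sum.inr 0)) f‖ ≤
      ((d : ℝ) + 1) * (Bh * (d * R ^ d)) * ‖θ (Sum.inr 0) - γ (Sum.inr 0)‖ := by
    simpa only [hfα, sub_zero] using norm_aeval_sub_aeval_le f hR1 hξR hαR hcoeff hfd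
  have hD : ((d : ℝ) + 1) * (Bh * (d * R ^ d)) ≤ Real.exp ((4 + Real.log R) * d + Real.log H) := by
    have e1 : Real.exp d * Real.exp d * Real.exp d * Real.exp d * R ^ d * H =
        Real.exp ((4 + Real.log R) * d + Real.log H) := by
      rw [show (4 + Real.log R) * d + Real.log H =
          (d : ℝ) + d + d + d + Real.log R * d + Real.log H by ring]
      simp only [Real.exp_add]
      rw [Real.exp_log hH0, ← Real.rpow_def_of_pos (one_pos.trans_le hR1), Real.rpow_natCast]
    have j3 : (d : ℝ) ≤ Real.exp d := by linarith
    rw [← e1, hBh]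
    calc ((d : ℝ) + 1) * (2 ^ d * ((d : ℝ) + 1) * H * (d * R ^ d))
        = ((d : ℝ) + 1) * 2 ^ d * ((d : ℝ) + 1) * d * R ^ d * H := by ring
      _ ≤ Real.exp d * Real.exp d * Real.exp d * Real.exp d * R ^ d * H := by gcongr
  -- exponent bookkeeping below `exp(d^{b₀})`: everything is `≤ C' d^B`
  have key : C * ((d : ℝ) + Real.log Bh) ^ τ + ((4 + Real.log R) * d + Real.log H) ≤
      C' * (d : ℝ) ^ B := by
    have hLH : Real.log H ≤ (d : ℝ) ^ B₀ :=
      ((Real.log_lt_iff_lt_exp hH0).2 hHlt).le.trans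
        (Real.rpow_le_rpow_of_exponent_le hd1r (le_max_left _ _))
    have hdB₀ : (d : ℝ) ≤ (d : ℝ) ^ B₀ := by
      calc (d : ℝ) = (d : ℝ) ^ (1 : ℝ) := (Real.rpow_one _).symm
        _ ≤ (d : ℝ) ^ B₀ := Real.rpow_le_rpow_of_exponent_le hd1r hB₀1
    have hdB₀0 : 0 ≤ (d : ℝ) ^ B₀ := Real.rpow_nonneg hd0.le _
    have hbase1 : 1 ≤ (d : ℝ) + Real.log Bh := by linarith [Real.log_nonneg hBh1]
    have hbase : (d : ℝ) + Real.log Bh ≤ 4 * (d : ℝ) ^ B₀ := by linarith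
    have hpow1 : ((d : ℝ) + Real.log Bh) ^ τ ≤ ((d : ℝ) + Real.log Bh) ^ τp :=
      Real.rpow_le_rpow_of_exponent_le hbase1 (le_max_left _ _)
    have hpow2 : ((d : ℝ) + Real.log Bh) ^ τp ≤ (4 * (d : ℝ) ^ B₀) ^ τp :=
      Real.rpow_le_rpow (by linarith) hbase hτp0
    have hpow3 : (4 * (d : ℝ) ^ B₀) ^ τp = (4 : ℝ) ^ τp * (d : ℝ) ^ (B₀ * τp) := by
      rw [Real.mul_rpow (by norm_num) hdB₀0, ← Real.rpow_mul hd0.le]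
    have hexp1 : (d : ℝ) ^ (B₀ * τp) ≤ (d : ℝ) ^ B :=
      Real.rpow_le_rpow_of_exponent_le hd1r (by rw [hB]; linarith)
    have hexp2 : (d : ℝ) ^ B₀ ≤ (d : ℝ) ^ B :=
      Real.rpow_le_rpow_of_exponent_le hd1r (by rw [hB]; nlinarith)
    have t0 : ((d : ℝ) + Real.log Bh) ^ τ ≤ (4 : ℝ) ^ τp * (d : ℝ) ^ B :=
      (hpow1.trans (hpow2.trans hpow3.le)).trans (mul_le_mul_of_nonneg_left hexp1 h4p)
    have t1 : C * ((d : ℝ) + Real.log Bh) ^ τ ≤ C * (4 : ℝ) ^ τp * (d : ℝ) ^ B := by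
      rw [mul_assoc]; exact mul_le_mul_of_nonneg_left t0 hC.le
    have t2 : (4 + Real.log R) * d + Real.log H ≤ (5 + Real.log R) * (d : ℝ) ^ B := by
      have : (4 + Real.log R) * d ≤ (4 + Real.log R) * (d : ℝ) ^ B :=
        mul_le_mul_of_nonneg_left (hdB₀.trans hexp2) (by linarith)
      linarith [hLH.trans hexp2]
    have hsplit : C' * (d : ℝ) ^ B = C * (4 : ℝ) ^ τp * (d : ℝ) ^ B + (5 + Real.log R) * (d : ℝ) ^ B := by
      rw [hC']; ring
    rw [hsplit]; linarith
  -- chain the three bounds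
  have hchain : Real.exp (-(C * ((d : ℝ) + Real.log Bh) ^ τ)) ≤
      Real.exp ((4 + Real.log R) * d + Real.log H) * ‖γ (Sum.inr 0) - θ (Sum.inr 0)‖ := by
    rw [norm_sub_rev]
    exact hlow.trans (hmv.trans (mul_le_mul_of_nonneg_right hD (norm_nonneg _)))
  have hmul : Real.exp ((4 + Real.log R) * d + Real.log H) * Real.exp (-(C' * (d : ℝ) ^ B)) ≤
      Real.exp ((4 + Real.log R) * d + Real.log H) * ‖γ (Sum.inr 0) - θ (Sum.inr 0)‖ := by
    rw [← Real.exp_add]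
    exact le_trans (Real.exp_le_exp.2 (by linarith)) hchain
  exact (le_of_mul_le_mul_left hmul (Real.exp_pos _)).trans hcoord

/-- **ABOVE ∧ WINDOW ∧ FLOOR ⇒ the typed pointwise bound** at an `n = 2` point (the skeleton's
`approxTypeAt_of_pen_window_floor`): the penalty form (`a < 1`, threshold
`T_κ(d) = exp(exp(κ d log(d+2)))`), the typed bound in the window `exp(d^{b₀}) ≤ H < T_κ(d)`
(`a_W < 1`) and a pure-power floor `exp(−C_F d^{b_F})` below `exp(d^{b₀})` give
`ApproxTypeAt 2 s a' b' C'` with `a' = max(a⁺, a_W) < 1`, `b' = max(b_W, b_F)`,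
`C' = max(C + 1, C_W, C_F)`. [folklore] -/
theorem approxTypeAt_of_pen_window_floor {s : Fin 2 → ℂ} {a κ C : ℝ} (ha : a < 1)
    (hpen : ApproxTypePenAt 2 s a κ C) {b₀ aW bW CW : ℝ} (haW : aW < 1) (hCW : 0 < CW)
    (hW : ∀ (d H : ℕ) (γ : Fin 2 ⊕ Fin 2 → ℂ), Real.exp ((d : ℝ) ^ b₀) ≤ (H : ℝ) →
      (H : ℝ) < Real.exp (Real.exp (κ * d * Real.log ((d : ℝ) + 2))) →
      Module.finrank ℚ ↥(IntermediateField.adjoin ℚ (Set.range γ)) ≤ d →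
      (∀ i, ∃ P : Polynomial ℤ, P ≠ 0 ∧ P.natDegree ≤ d ∧ (∀ k, |P.coeff k| ≤ (H : ℤ)) ∧
        Polynomial.aeval (γ i) P = 0) →
      Real.exp (-(CW * ((d : ℝ) ^ aW * Real.log H + (d : ℝ) ^ bW))) ≤
        ‖γ - Sum.elim s (Complex.exp ∘ s)‖)
    {bF CF : ℝ} (hCF : 0 < CF)
    (hF : ∀ (d H : ℕ) (γ : Fin 2 ⊕ Fin 2 → ℂ), (H : ℝ) < Real.exp ((d : ℝ) ^ b₀) →
      Module.finrank ℚ ↥(IntermediateField.adjoin ℚ (Set.range γ)) ≤ d →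
      (∀ i, ∃ P : Polynomial ℤ, P ≠ 0 ∧ P.natDegree ≤ d ∧ (∀ k, |P.coeff k| ≤ (H : ℤ)) ∧
        Polynomial.aeval (γ i) P = 0) →
      Real.exp (-(CF * (d : ℝ) ^ bF)) ≤ ‖γ - Sum.elim s (Complex.exp ∘ s)‖) :
    ∃ a' b' C' : ℝ, a' < 1 ∧ ApproxTypeAt 2 s a' b' C' := by
  have hC : 0 < C := hpen.1
  set a' : ℝ := max (max a 0) aW with ha'
  set b' : ℝ := max bW bF with hb'
  set C' : ℝ := max (C + 1) (max CW CF) with hC'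
  have ha'1 : a' < 1 := max_lt (max_lt ha one_pos) haW
  have hC'pos : 0 < C' := lt_of_lt_of_le (by linarith) (le_max_left _ _)
  refine ⟨a', b', C', ha'1, hC'pos, ?_⟩
  intro d H γ hfr hpoly
  obtain ⟨hd1, hH1⟩ := one_le_of_clause (hpoly (Sum.inl 0))
  have hd0 : (0 : ℝ) < d := one_pos.trans_le hd1
  have hlogH : 0 ≤ Real.log H := Real.log_nonneg hH1
  by_cases hA : Real.exp (Real.exp (κ * d * Real.log ((d : ℝ) + 2))) ≤ (H : ℝ)
  · -- ABOVE the threshold: the penalty form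
    refine le_trans (Real.exp_le_exp.2 (neg_le_neg ?_)) (typed_above_of_pen hpen b' d H γ hA hfr hpoly)
    exact typedExponent_mono hd1 hlogH (by linarith) (le_max_left _ _) (le_max_left _ _) le_rfl
  push Not at hA
  by_cases hWin : Real.exp ((d : ℝ) ^ b₀) ≤ (H : ℝ)
  · -- the WINDOW
    refine le_trans (Real.exp_le_exp.2 (neg_le_neg ?_)) (hW d H γ hWin hA hfr hpoly)
    exact typedExponent_mono hd1 hlogH hCW.le ((le_max_left _ _).trans (le_max_right _ _))
      (le_max_right _ _) (le_max_left _ _)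
  · -- BELOW `exp(d^{b₀})`: the pure-power floor
    push Not at hWin
    refine le_trans (Real.exp_le_exp.2 (neg_le_neg ?_)) (hF d H γ hWin hfr hpoly)
    have h2 : (d : ℝ) ^ bF ≤ (d : ℝ) ^ b' := Real.rpow_le_rpow_of_exponent_le hd1 (le_max_right _ _)
    have h3 : CF ≤ C' := (le_max_right _ _).trans (le_max_right _ _)
    have hda' : 0 ≤ (d : ℝ) ^ a' * Real.log H := mul_nonneg (Real.rpow_nonneg hd0.le _) hlogH
    have hdb' : 0 ≤ (d : ℝ) ^ b' := Real.rpow_nonneg hd0.le _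
    have hdbF : 0 ≤ (d : ℝ) ^ bF := Real.rpow_nonneg hd0.le _
    nlinarith [h2, h3, hda', hdb', hCF, hdbF]

/-- **The LW layer of the typed (all-heights) bound from stubs 1, 4, 5** (the skeleton's
`approxTypeAt_two_of_LW_windows`, stubs 2–3 landed): at `s ∈ ℚ̄²` with `ℚ`-linearly independent
coordinates, ABOVE (penalty form at threshold `κ`) + the WINDOW at that `κ` (stub 5, choosing
`b₀`) + the FLOOR below `exp(d^{b₀})` (stub 4 at the slot `e^{s₀}`, `s₀ ≠ 0` by linear
independence) give `∃ a < 1, ApproxTypeAt 2 s a b C`. [folklore] -/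
theorem approxTypeAt_two_of_LW_windows (h₁ : LWPenaltyMeasure)
    (hE : ExpFiniteType) (hW : LWWindowTwo) (s : Fin 2 → ℂ)
    (halg : ∀ i, IsAlgebraic ℚ (s i)) (hli : LinearIndependent ℚ s) :
    ∃ a b C : ℝ, a < 1 ∧ ApproxTypeAt 2 s a b C := by
  obtain ⟨a, κ, C, ha, hpen⟩ := approxTypePenAt_two_of_lwPenaltyMeasure h₁ s halg hli
  obtain ⟨b₀, aW, bW, CW, haW, hCW, hwin⟩ := hW s halg hli κ
  obtain ⟨τ, C₁, hft⟩ := hE (s 0) (halg 0) (hli.ne_zero 0)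
  obtain ⟨bF, CF, hCF, hfloor⟩ := approxFloor_of_finiteType s hft b₀
  exact approxTypeAt_of_pen_window_floor ha hpen haW hCW hwin hCF hfloor

/-- **The stub statements imply the item, pointwise form** (the skeleton's
`khovanskiiApproxType_of_stubs` with stubs 2–3 discharged): `n ≥ 3` is the residual stub; at `n = 2`
the LW layer is `approxTypeAt_two_of_LW_windows`, and off the LW layer the inputs stub feeds the
landed `approxTypeAt_two_of_inputs` (p78384). [folklore] -/
theorem approxTypeAt_of_stubs (h₁ : LWPenaltyMeasure) (hE : ExpFiniteType)
    (hW : LWWindowTwo) (hN : NonLWInputsTwo) (hR : RankThreeUp)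
    (n : ℕ) (s : Fin n → ℂ) (hn : 2 ≤ n) (hli : LinearIndependent ℚ s)
    (hfree : IsFreeKhovanskii n s) :
    ∃ a b C : ℝ, a < 1 / ((n : ℝ) - 1) ∧ ApproxTypeAt n s a b C := by
  by_cases h3 : 3 ≤ n
  · exact hR n s h3 hli hfree
  obtain rfl : n = 2 := by omega
  have key : ∃ a b C : ℝ, a < 1 ∧ ApproxTypeAt 2 s a b C := by
    by_cases halg : ∀ i, IsAlgebraic ℚ (s i)
    · exact approxTypeAt_two_of_LW_windows h₁ hE hW s halg hli
    · push Not at halg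
      obtain ⟨i, hi⟩ := halg
      obtain ⟨e, he, μ, K, C, A, hμ, hK, hA, hrace, hC, hfl⟩ := hN s hli hfree ⟨i, hi⟩
      exact approxTypeAt_two_of_inputs s e he μ K C A hμ hK hA hrace hC hfl
  obtain ⟨a, b, C, ha, hat⟩ := key
  refine ⟨a, b, C, ?_, hat⟩
  have h1 : (1 : ℝ) / (((2 : ℕ) : ℝ) - 1) = 1 := by norm_num
  rw [h1]
  exact ha

end WindowComposition

open WindowComposition

/-- **`KhovanskiiApproxType` (stmt-Schanuel-6116) from Ably's theorem and the four remaining stub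
STATEMENTS of line `height-window-compactness`** — the item's exact residual after this pass
(stubs 2–3 landed: p85905, p94631): the cited `Ably1994_lindemannWeierstrass_measure` (stub 1,
vendored named fact), `ExpFiniteType` (stub 4, printed: Lang's finite type of `e^β`),
`LWWindowTwo` (stub 5, OPEN), `NonLWInputsTwo` (stub 6, Schanuel-strength), `RankThreeUp`
(stub 7 = the item for `n ≥ 3`, OPEN) imply the item BY NAME. Registered stub
`khovanskiiApproxType_of_ably`. [cite: Ably1994, Théorème p. 30] -/
theorem khovanskiiApproxType_of_ably :
    Literature.NumberTheory.Transcendental.Ably1994_lindemannWeierstrass_measure → ExpFiniteType →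
      LWWindowTwo → NonLWInputsTwo → RankThreeUp →
      Summit.Schanuel.Schanuel.Theses.DiophantineDichotomy.KhovanskiiApproxType :=
  fun hA hE hW hN hR =>
    khovanskiiApproxType_iff.2 (approxTypeAt_of_stubs (lwPenaltyMeasure_of_ably hA) hE hW hN hR)

/-- **`KhovanskiiApproxType` (stmt-Schanuel-6116) from the two PRINTED theorems and the three OPEN
stub statements**: Ably 1994 (Théorème p. 30, stub 1) and Waldschmidt 1978 (Corollary 3.9, giving
stub 4 `ExpFiniteType` by `expFiniteType_of_waldschmidt`) — both vendored named facts — plus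
`LWWindowTwo`, `NonLWInputsTwo`, `RankThreeUp` imply the item by name. This is the item's residual
in the form "printed ∧ printed ∧ open ∧ open ∧ open". Registered sub-goal
`khovanskiiApproxType_of_printed`. [cite: Waldschmidt1978, Corollary 3.9] -/
theorem khovanskiiApproxType_of_printed :
    Literature.NumberTheory.Transcendental.Ably1994_lindemannWeierstrass_measure →
      Literature.NumberTheory.Transcendental.Waldschmidt1978_cor_3_9 →
      LWWindowTwo → NonLWInputsTwo → RankThreeUp →
      Summit.Schanuel.Schanuel.Theses.DiophantineDichotomy.KhovanskiiApproxType :=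
  fun hA hW78 hW hN hR =>
    khovanskiiApproxType_of_ably hA (expFiniteType_of_waldschmidt hW78) hW hN hR

end Summit.Schanuel.Schanuel.Cruxes.KhovanskiiApproxType.HeightWindowCompactness

end
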